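import Mathlib
import Summits.NavierStokesRegularity.NavierStokesRegularity.Theorems.RotatedEulerWindowDecayFluxRecurrenceLiouville
import Literature.Analysis.FluidPDE.VectorCalculus
import Literature.Analysis.FluidPDE.AxisymmetricVorticityTransport
import Literature.Analysis.ODE.FlowWithin
import HarnessLib

/-!
# Flow tools for the axisymmetric decaying-swirl Liouville theorem
  (route `AffineBernoulli`, item `AxisymDecayingSwirlLiouville`, stmt-NavierStokesRegularity-13905)

Helper file (all results proved; no definitions, no named facts) for the Pomeau–Le Berre case of the
Euler–Leray Liouville problem. For a `C¹`, globally Lipschitz field `g` with complete flow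
`Ψ = Literature.Analysis.ODE.lipschitzFlow`:

* `DecayFlux.fderiv_flow_apply_eq_exp_smul` — **the flow transports an affinely commuting field up to
  a scalar**: if `Ω ∈ C¹` satisfies `DΩ·g = Dg·Ω + κΩ`, then `DΨ_T(x) Ω(x) = e^{−κT} Ω(Ψ_T x)` for
  `T ≥ 0` (variational equation `IsSolutionFamily.hasFDerivWithinAt` + uniqueness for the linear
  equation `Y' = Dg(Ψ_t x)Y + κY`; the finite-dimensional-`E` form of the tree's
  `ProfileClock.fderiv_flow_apply_eq`).
* `AxisymFlow.flow_rotZ` — the flow of an AXISYMMETRIC field on `ℝ³` commutes with the rotations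
  about the axis (uniqueness of integral curves), hence `AxisymFlow.isAxisymmetric_flow_slice`,
  `AxisymFlow.fderiv_flow_rotGen` (`DΨ_T(x)(Jx) = J(Ψ_T x)`, infinitesimal form) and
  `AxisymFlow.offAxis_flow` (an orbit through a point off the axis never meets the axis).
* `SimilarityFlow.monotone_norm_sq_flow_mul_exp` — for the CENTRED similarity field `V = ½y + W` with
  `‖W y‖ ≤ C(1+‖y‖)⁻¹` the function `(‖Ψ q s‖² − 2C)e^{−s}` is non-decreasing (outward far field,
  `SimilarityFlow.two_inner_ge_zero`); hence backward orbits are bounded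
  (`SimilarityFlow.norm_sq_flow_le_of_nonpos_zero`) and orbits outside the ball `‖y‖² ≤ 2C + 1` run
  to infinity (`SimilarityFlow.sub_mul_exp_le_of_nonneg_zero`). (The general-centre twin
  `SimilarityFlow.two_inner_ge` lives in `AffineBernoulliEulerLerayLiouvilleFirstIntegralRigidity`.)

References: S. Lang, *Differential and Riemannian Manifolds* (1995) IV §1; V. I. Arnold, B. Khesin,
*Topological Methods in Hydrodynamics*, Ch. II §1; Chae–Wolf, arXiv:1901.09426, §2.

HONEST FRAMING: ODE lemmas about the similarity flow of HYPOTHETICAL self-similar Euler profiles;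
nothing here bears on the regularity problem itself.
-/

noncomputable section

set_option linter.dupNamespace false

namespace Summit.NavierStokesRegularity.NavierStokesRegularity.Theorems

open Set Function Filter Topology MeasureTheory Metric
open scoped NNReal ENNReal ContDiff RealInnerProductSpace
open Literature.Analysis.ODE Literature.Analysis.FluidPDE

namespace DecayFlux

variable {E : Type*} [NormedAddCommGroup E] [NormedSpace ℝ E] [CompleteSpace E]

/-- The time-`T` map of the global flow of a `C¹` globally Lipschitz field is differentiable. -/
theorem differentiable_flow_slice {g : E → E} {K : ℝ≥0} (hK : LipschitzWith K g)
    (hg : ContDiff ℝ 1 g) (T : ℝ) : Differentiable ℝ fun q => lipschitzFlow hK q T := by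
  have h := contDiff_lipschitzFlow hg le_rfl hK
  have h2 : ContDiff ℝ 1 fun q : E => (q, T) := contDiff_id.prodMk contDiff_const
  exact (h.comp h2).differentiable (by simp)

/-- **The flow transports an affinely commuting field up to a scalar** (finite-dimensional form of the
tree's `ProfileClock.fderiv_flow_apply_eq`): for `g ∈ C¹` globally Lipschitz and `Ω ∈ C¹` with
`DΩ(y) g(y) = Dg(y) Ω(y) + κ Ω(y)`, the global flow `Ψ` of `g` satisfies
`DΨ_T(x) Ω(x) = e^{−κT} Ω(Ψ_T x)` for `T ≥ 0`. [cite: Lang1995, Ch. IV §1, Thm. 1.14] -/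
theorem fderiv_flow_apply_eq_exp_smul {g Ω : E → E} {K : ℝ≥0} (hK : LipschitzWith K g)
    (hg : ContDiff ℝ 1 g) (hΩ : ContDiff ℝ 1 Ω) {κ : ℝ}
    (hcomm : ∀ y, fderiv ℝ Ω y (g y) = fderiv ℝ g y (Ω y) + κ • Ω y)
    {T : ℝ} (hT : 0 ≤ T) (x : E) :
    fderiv ℝ (fun q => lipschitzFlow hK q T) x (Ω x) =
      Real.exp (-(κ * T)) • Ω (lipschitzFlow hK x T) := by
  set u : E → ℝ → E := lipschitzFlow hK with hu
  have hfam : IsSolutionFamily g univ univ T u :=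
    ⟨fun y _ => lipschitzFlow_zero hK y,
      fun y _ τ _ => (hasDerivAt_lipschitzFlow hK y τ).hasDerivWithinAt, fun _ _ _ _ => mem_univ _⟩
  obtain ⟨J, hJ0, hJ⟩ := hfam.exists_linearization hT uniqueDiffOn_univ hg.contDiffOn
  have hderiv : HasFDerivWithinAt (fun y' => u y' T) (J x T) univ x :=
    hfam.hasFDerivWithinAt hT convex_univ uniqueDiffOn_univ hg.contDiffOn (mem_univ x)
      (hJ0 x (mem_univ x)) (hJ x (mem_univ x)) ⟨hT, le_rfl⟩
  have hfd : fderiv ℝ (fun q => u q T) x = J x T :=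
    (hderiv.hasFDerivAt univ_mem).fderiv
  -- the coefficient `A t = DF(Ψ_t x)` and its bound on `[0, T]`
  set A : ℝ → E →L[ℝ] E := fun t => fderiv ℝ g (u x t) with hA
  have hJ' : ∀ t ∈ Icc 0 T, HasDerivWithinAt (J x) ((A t).comp (J x t)) (Icc 0 T) t := by
    intro t ht
    have h := hJ x (mem_univ x) t ht
    rwa [fderivWithin_univ] at h
  have hAcont : ContinuousOn A (Icc 0 T) :=
    ((hg.continuous_fderiv one_ne_zero).comp (continuous_lipschitzFlow hK x)).continuousOn
  obtain ⟨M, hM⟩ := isCompact_Icc.exists_bound_of_continuousOn hAcont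
  have hM0 : 0 ≤ max M 0 := le_max_right _ _
  -- the linear field `v t w = A t w + κ w`, Lipschitz on `[0, T)`
  set v : ℝ → E → E := fun t w => A t w + κ • w with hv
  set Kv : ℝ≥0 := ⟨max M 0 + |κ|, by positivity⟩ with hKv
  have hlip : ∀ t ∈ Ico 0 T, LipschitzOnWith Kv (v t) univ := by
    intro t ht
    refine LipschitzOnWith.of_dist_le_mul fun w _ w' _ => ?_
    rw [dist_eq_norm, dist_eq_norm]
    have e : v t w - v t w' = A t (w - w') + κ • (w - w') := by
      simp only [hv, map_sub, smul_sub]; abel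
    rw [e]
    have h1 : ‖A t (w - w')‖ ≤ max M 0 * ‖w - w'‖ :=
      (ContinuousLinearMap.le_opNorm _ _).trans
        (mul_le_mul_of_nonneg_right ((hM t (Ico_subset_Icc_self ht)).trans (le_max_left _ _))
          (norm_nonneg _))
    have h2 : ‖κ • (w - w')‖ = |κ| * ‖w - w'‖ := by rw [norm_smul, Real.norm_eq_abs]
    have hKv' : (Kv : ℝ) = max M 0 + |κ| := rfl
    calc ‖A t (w - w') + κ • (w - w')‖ ≤ ‖A t (w - w')‖ + ‖κ • (w - w')‖ := norm_add_le _ _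
      _ ≤ max M 0 * ‖w - w'‖ + |κ| * ‖w - w'‖ := by rw [h2]; exact add_le_add h1 le_rfl
      _ = (Kv : ℝ) * ‖w - w'‖ := by rw [hKv']; ring
  -- `B t = Ω(Ψ_t x)` solves `B' = v t B`
  set B : ℝ → E := fun t => Ω (u x t) with hB
  have hBd : ∀ t, HasDerivAt B (v t (B t)) t := by
    intro t
    have h1 : HasDerivAt (u x) (g (u x t)) t := hasDerivAt_lipschitzFlow hK x t
    have h2 : HasFDerivAt Ω (fderiv ℝ Ω (u x t)) (u x t) :=
      ((hΩ.differentiable one_ne_zero) _).hasFDerivAt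
    have h3 := h2.comp_hasDerivAt t h1
    rw [hcomm] at h3
    exact h3
  -- `C t = e^{κt} J_t Ω(x)` solves `C' = v t C` within `[0, T]`
  set C : ℝ → E := fun t => Real.exp (κ * t) • J x t (Ω x) with hC
  have hCd : ∀ t ∈ Ico 0 T, HasDerivWithinAt C (v t (C t)) (Ici t) t := by
    intro t ht
    have hJt : HasDerivWithinAt (J x) ((A t).comp (J x t)) (Ici t) t :=
      (hJ' t (Ico_subset_Icc_self ht)).mono_of_mem_nhdsWithin
        (mem_of_superset (Icc_mem_nhdsGE ht.2) (Icc_subset_Icc ht.1 le_rfl))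
    have hJw : HasDerivWithinAt (fun s => J x s (Ω x)) ((A t).comp (J x t) (Ω x)) (Ici t) t := by
      have h := hJt.clm_apply (hasDerivWithinAt_const t (Ici t) (Ω x))
      simpa using h
    have hexp : HasDerivWithinAt (fun s => Real.exp (κ * s)) (Real.exp (κ * t) * κ) (Ici t) t := by
      have h := (Real.hasDerivAt_exp (κ * t)).comp t ((hasDerivAt_id t).const_mul κ)
      simp only [mul_one] at h
      exact h.hasDerivWithinAt
    have h := hexp.smul hJw
    refine h.congr_deriv ?_
    simp only [hv, hC, ContinuousLinearMap.comp_apply, map_smul, smul_smul]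
    module
  -- continuity of `C` on `[0, T]`
  have hCcont : ContinuousOn C (Icc 0 T) := by
    have hexpc : ContinuousOn (fun t : ℝ => Real.exp (κ * t)) (Icc 0 T) := by fun_prop
    refine hexpc.smul ?_
    intro t ht
    exact ((hJ' t ht).continuousWithinAt).clm_apply continuousWithinAt_const
  -- uniqueness
  have h0 : B 0 = C 0 := by
    simp only [hB, hC, hu, lipschitzFlow_zero, mul_zero, Real.exp_zero, one_smul, hJ0 x (mem_univ x)]
    rfl
  have hBC : EqOn B C (Icc 0 T) :=
    ODE_solution_unique_of_mem_Icc_right hlip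
      (fun t _ => (hBd t).continuousAt.continuousWithinAt)
      (fun t _ => (hBd t).hasDerivWithinAt) (fun _ _ => mem_univ _)
      hCcont hCd (fun _ _ => mem_univ _) h0
  have hTT := hBC ⟨hT, le_rfl⟩
  simp only [hB, hC] at hTT
  rw [hfd, hTT, smul_smul, ← Real.exp_add, neg_add_cancel, Real.exp_zero, one_smul]


end DecayFlux

/-! ### The flow of an axisymmetric field commutes with the rotations about the axis -/

namespace AxisymFlow

/-- The rotations about the axis fix exactly... (helper): a vector fixed by the rotation by `π` about
the axis has vanishing horizontal components. -/
theorem horizontal_eq_zero_of_rotZ_pi_eq {v : EuclideanSpace ℝ (Fin 3)} (h : rotZ Real.pi v = v) :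
    v 0 = 0 ∧ v 1 = 0 := by
  have h0 := congrArg (fun w : EuclideanSpace ℝ (Fin 3) => w 0) h
  have h1 := congrArg (fun w : EuclideanSpace ℝ (Fin 3) => w 1) h
  simp only [rotZ_apply_zero, rotZ_apply_one, Real.cos_pi, Real.sin_pi] at h0 h1
  constructor <;> linarith

variable {V : EuclideanSpace ℝ (Fin 3) → EuclideanSpace ℝ (Fin 3)} {K : ℝ≥0}

/-- **The flow of an axisymmetric, globally Lipschitz field commutes with the rotations about the
axis**: `Ψ (R_θ x) t = R_θ (Ψ x t)` (both sides are integral curves through `R_θ x`). [folklore] -/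
theorem flow_rotZ (hK : LipschitzWith K V) (hax : IsAxisymmetric V) (θ : ℝ)
    (x : EuclideanSpace ℝ (Fin 3)) (t : ℝ) :
    lipschitzFlow hK (rotZ θ x) t = rotZ θ (lipschitzFlow hK x t) := by
  have hγ : ∀ s, HasDerivAt (fun s => rotZ θ (lipschitzFlow hK x s))
      (V (rotZ θ (lipschitzFlow hK x s))) s := by
    intro s
    have h1 := (rotZL θ).hasFDerivAt.comp_hasDerivAt s (hasDerivAt_lipschitzFlow hK x s)
    rw [rotZL_apply, ← hax θ] at h1
    exact h1
  have h := eq_lipschitzFlow_of_hasDerivAt hK (γ := fun s => rotZ θ (lipschitzFlow hK x s))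
    (a := -(|t| + 1)) (b := |t| + 1) (t₀ := 0) ⟨by linarith [abs_nonneg t], by linarith [abs_nonneg t]⟩
    (fun s _ => hγ s) (t := t) ⟨by linarith [neg_abs_le t], by linarith [le_abs_self t]⟩
  simp only [lipschitzFlow_zero, sub_zero] at h
  exact h.symm

/-- Each time-`t` map of the flow of an axisymmetric field is axisymmetric. [folklore] -/
theorem isAxisymmetric_flow_slice (hK : LipschitzWith K V) (hax : IsAxisymmetric V) (t : ℝ) :
    IsAxisymmetric fun q => lipschitzFlow hK q t :=
  fun θ x => flow_rotZ hK hax θ x t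

/-- **Infinitesimal form**: `DΨ_t(x)(J x) = J (Ψ_t x)` for the flow of a `C¹` axisymmetric,
globally Lipschitz field (`J = rotGen` the generator of the rotations). [folklore] -/
theorem fderiv_flow_rotGen (hK : LipschitzWith K V) (hV : ContDiff ℝ 1 V) (hax : IsAxisymmetric V)
    (t : ℝ) (x : EuclideanSpace ℝ (Fin 3)) :
    fderiv ℝ (fun q => lipschitzFlow hK q t) x (rotGen x) = rotGen (lipschitzFlow hK x t) :=
  (isAxisymmetric_flow_slice hK hax t).fderiv_rotGen
    ((DecayFlux.differentiable_flow_slice hK hV t) x)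

/-- The axis is invariant: an orbit of an axisymmetric field starting on the axis stays on it.
[folklore] -/
theorem onAxis_flow (hK : LipschitzWith K V) (hax : IsAxisymmetric V)
    {x : EuclideanSpace ℝ (Fin 3)} (hx : x 0 = 0 ∧ x 1 = 0) (t : ℝ) :
    lipschitzFlow hK x t 0 = 0 ∧ lipschitzFlow hK x t 1 = 0 := by
  apply horizontal_eq_zero_of_rotZ_pi_eq
  have hfix : rotZ Real.pi x = x := by
    ext i
    fin_cases i <;> simp [hx.1, hx.2]
  rw [← flow_rotZ hK hax, hfix]

/-- Consequently an orbit through a point OFF the axis never meets the axis. [folklore] -/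
theorem offAxis_flow (hK : LipschitzWith K V) (hax : IsAxisymmetric V)
    {x : EuclideanSpace ℝ (Fin 3)} (hx : ¬(x 0 = 0 ∧ x 1 = 0)) (t : ℝ) :
    ¬(lipschitzFlow hK x t 0 = 0 ∧ lipschitzFlow hK x t 1 = 0) := by
  intro h
  apply hx
  have h2 := onAxis_flow hK hax h (-t)
  rwa [lipschitzFlow_neg_lipschitzFlow] at h2

end AxisymFlow

/-! ### The centred similarity flow: outward far field, growth, backward boundedness -/

namespace SimilarityFlow

/-- The outward inequality of the centred similarity field: for `‖W y‖ ≤ C (1+‖y‖)⁻¹`,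
`‖y‖² − 2C ≤ 2⟪y, ½y + W y⟫`. [folklore] -/
theorem two_inner_ge_zero {W : EuclideanSpace ℝ (Fin 3) → EuclideanSpace ℝ (Fin 3)} {C : ℝ}
    (hC : 0 ≤ C) (hW : ∀ y, ‖W y‖ ≤ C * (1 + ‖y‖)⁻¹) (y : EuclideanSpace ℝ (Fin 3)) :
    ‖y‖ ^ 2 - 2 * C ≤ 2 * ⟪y, (1 / 2 : ℝ) • y + W y⟫ := by
  have h1 : ⟪y, (1 / 2 : ℝ) • y + W y⟫ = (1 / 2) * ‖y‖ ^ 2 + ⟪y, W y⟫ := by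
    rw [inner_add_right, inner_smul_right, real_inner_self_eq_norm_sq]
  have h2 : |⟪y, W y⟫| ≤ C := by
    have hy : 0 < 1 + ‖y‖ := by positivity
    calc |⟪y, W y⟫| ≤ ‖y‖ * ‖W y‖ := abs_real_inner_le_norm _ _
      _ ≤ ‖y‖ * (C * (1 + ‖y‖)⁻¹) := mul_le_mul_of_nonneg_left (hW y) (norm_nonneg _)
      _ = C * (‖y‖ / (1 + ‖y‖)) := by ring
      _ ≤ C * 1 := by
          refine mul_le_mul_of_nonneg_left ?_ hC
          rw [div_le_one hy]
          linarith
      _ = C := mul_one C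
  rw [h1]
  linarith [neg_abs_le ⟪y, W y⟫]

variable {V W : EuclideanSpace ℝ (Fin 3) → EuclideanSpace ℝ (Fin 3)} {K : ℝ≥0} {C : ℝ}

/-- **Growth along the centred similarity flow**: for `V = ½y + W` with `‖W y‖ ≤ C(1+‖y‖)⁻¹`,
`s ↦ (‖Ψ q s‖² − 2C) e^{−s}` is non-decreasing (its derivative is
`(2⟪Ψ, V Ψ⟫ − (‖Ψ‖² − 2C)) e^{−s} ≥ 0`). [folklore] -/
theorem monotone_norm_sq_flow_mul_exp (hK : LipschitzWith K V)
    (hV : ∀ y, V y = (1 / 2 : ℝ) • y + W y) (hC : 0 ≤ C) (hW : ∀ y, ‖W y‖ ≤ C * (1 + ‖y‖)⁻¹)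
    (q : EuclideanSpace ℝ (Fin 3)) :
    Monotone fun s => (‖lipschitzFlow hK q s‖ ^ 2 - 2 * C) * Real.exp (-s) := by
  have hφd : ∀ s, HasDerivAt (fun s => (‖lipschitzFlow hK q s‖ ^ 2 - 2 * C) * Real.exp (-s))
      ((2 * ⟪lipschitzFlow hK q s, V (lipschitzFlow hK q s)⟫ -
        (‖lipschitzFlow hK q s‖ ^ 2 - 2 * C)) * Real.exp (-s)) s := by
    intro s
    have h1 : HasDerivAt (fun s => ‖lipschitzFlow hK q s‖ ^ 2 - 2 * C)
        (2 * ⟪lipschitzFlow hK q s, V (lipschitzFlow hK q s)⟫) s := by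
      simpa using (hasDerivAt_lipschitzFlow hK q s).norm_sq.sub_const (2 * C)
    have h2 : HasDerivAt (fun s => Real.exp (-s)) (-Real.exp (-s)) s := by
      simpa using ((hasDerivAt_id s).neg).exp
    refine (h1.mul h2).congr_deriv ?_
    ring
  refine monotone_of_deriv_nonneg (fun s => (hφd s).differentiableAt) fun s => ?_
  rw [(hφd s).deriv]
  refine mul_nonneg ?_ (Real.exp_pos _).le
  have h := two_inner_ge_zero hC hW (lipschitzFlow hK q s)
  rw [hV]
  linarith

/-- **Backward orbits are bounded**: `‖Ψ q t‖² ≤ 2C + |‖q‖² − 2C|` for `t ≤ 0`. [folklore] -/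
theorem norm_sq_flow_le_of_nonpos_zero (hK : LipschitzWith K V)
    (hV : ∀ y, V y = (1 / 2 : ℝ) • y + W y) (hC : 0 ≤ C) (hW : ∀ y, ‖W y‖ ≤ C * (1 + ‖y‖)⁻¹)
    (q : EuclideanSpace ℝ (Fin 3)) {t : ℝ} (ht : t ≤ 0) :
    ‖lipschitzFlow hK q t‖ ^ 2 ≤ 2 * C + |‖q‖ ^ 2 - 2 * C| := by
  have h := monotone_norm_sq_flow_mul_exp hK hV hC hW q ht
  simp only [lipschitzFlow_zero, neg_zero, Real.exp_zero, mul_one] at h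
  have hexp : 1 ≤ Real.exp (-t) := Real.one_le_exp_iff.2 (by linarith)
  by_cases hcase : ‖lipschitzFlow hK q t‖ ^ 2 - 2 * C ≤ 0
  · linarith [abs_nonneg (‖q‖ ^ 2 - 2 * C)]
  · push Not at hcase
    have h1 : ‖lipschitzFlow hK q t‖ ^ 2 - 2 * C ≤
        (‖lipschitzFlow hK q t‖ ^ 2 - 2 * C) * Real.exp (-t) :=
      le_mul_of_one_le_right hcase.le hexp
    linarith [le_abs_self (‖q‖ ^ 2 - 2 * C)]

/-- **Forward growth**: `(‖q‖² − 2C) e^t ≤ ‖Ψ q t‖² − 2C` for `t ≥ 0`; in particular an orbit through a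
point with `‖q‖² > 2C` runs to infinity. [folklore] -/
theorem sub_mul_exp_le_of_nonneg_zero (hK : LipschitzWith K V)
    (hV : ∀ y, V y = (1 / 2 : ℝ) • y + W y) (hC : 0 ≤ C) (hW : ∀ y, ‖W y‖ ≤ C * (1 + ‖y‖)⁻¹)
    (q : EuclideanSpace ℝ (Fin 3)) {t : ℝ} (ht : 0 ≤ t) :
    (‖q‖ ^ 2 - 2 * C) * Real.exp t ≤ ‖lipschitzFlow hK q t‖ ^ 2 - 2 * C := by
  have h := monotone_norm_sq_flow_mul_exp hK hV hC hW q ht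
  simp only [lipschitzFlow_zero, neg_zero, Real.exp_zero, mul_one] at h
  have h2 := mul_le_mul_of_nonneg_right h (Real.exp_pos t).le
  rwa [mul_assoc, ← Real.exp_add, neg_add_cancel, Real.exp_zero, mul_one] at h2

end SimilarityFlow

end Summit.NavierStokesRegularity.NavierStokesRegularity.Theorems

end
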